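import Summits.QuantumFields.YangMills.Theorems.AllWindowsColdBoxBoxHighLineRestrictionSetCum4Slots

/-!
# U5 K4′ rows R6/R7 (part 1) — the CROSS term `CROSS(X, Y; Uᵒ, Uᵉ)` over a SYMMETRIC cut set `μ_{D′}`: helpers and the PARITY REDUCTION

Free-hands helper of the κ-lineage (ym-line-fcl-p3 g27) for LEAD ym-line-sfw-p2 g78's K4′ term table (`ym-idea-1/g78-K4PRIME-TERM-TABLE.md`, rows R6/R7,
offered to this seat 2026-08-30T00:49:58Z; U5 = `stub_landauThirdOrder`, ⟨stmt-QuantumFields-24336⟩, UNSTAFFED).  After (S1)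
`κ₄,₀(X,Y;Uᵒ+Uᵉ) = κ₄,₀(X,Y;Uᵒ) + κ₄,₀(X,Y;Uᵉ) + 2·CROSS(X,Y;Uᵒ,Uᵉ)` (✓`GaussRestrict.tiltCum4_muSet_zero_add_third`) the cross term between the ODD tilt part
`A = Uᵒ` and the EVEN tilt part `V = Uᵉ` of two parity-split observables `X = Xᵉ + Xᵒ`, `Y = Yᵉ + Yᵒ` loses five of its pieces by parity on a symmetric `D′`.
Over `μ_D := (volume.restrict D).withDensity (ofReal ∘ gaussWeight β H)` for an ARBITRARY measurable symmetric `D` (`hsym : ∀ a, −a ∈ D ↔ a ∈ D`) and observables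
measurable and bounded on `D`, with `E := Tilt.tiltExp μ_D W 0` in ANY tilt letter `W`:

* §1 helpers over `μ_D`: `tiltExp_muSet_zero_nonneg_on`, `tiltExp_muSet_zero_mono_on`, `abs_tiltExp_muSet_zero_pair_le` (Cauchy–Schwarz),
  `tiltExp_muSet_zero_centredSq_le` (`E[(V − E V)²] ≤ E[(V − b)²]`, any `b`);
* §2 ★ `cross_muSet_zero_parity_reduce`:
  `CROSS_W(Xᵉ+Xᵒ, Yᵉ+Yᵒ; A, V) = E[X̃ᵉ·Yᵒ·A·Ṽ] + E[Xᵒ·Ỹᵉ·A·Ṽ] − E[Xᵒ·A]·E[Ỹᵉ·Ṽ] − E[X̃ᵉ·Ṽ]·E[Yᵒ·A]`  (`X̃ᵉ = Xᵉ − E Xᵉ`, `Ṽ = V − E V`);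
* (part 2, `…RestrictionSetCrossParity`) ★★ `abs_cross_muSet_zero_parity_le_gaussAvg`: with `E₀[1 − 1_D] ≤ τ ≤ 1/2`, `sup_D |Xᵉ| ≤ S_X`, `sup_D |Yᵉ| ≤ S_Y` and ANY constant `b`,
  `|CROSS| ≤ 2S_X·√(√(2E₀[1_D Yᵒ⁴])·√(2E₀[1_D A⁴]))·√(2E₀[1_D(V−b)²]) + 2S_Y·√(√(2E₀[1_D Xᵒ⁴])·√(2E₀[1_D A⁴]))·√(2E₀[1_D(V−b)²])`
  `+ √(2E₀[1_D Xᵒ²])·√(2E₀[1_D A²])·(2S_Y·√(2E₀[1_D(V−b)²])) + (2S_X·√(2E₀[1_D(V−b)²]))·(√(2E₀[1_D Yᵒ²])·√(2E₀[1_D A²]))`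
  — the sizes stay in `E₀`-letters so the assembler plugs ✓13K-G (`gaussAvg_sfInd_odd_pow_four_le`), the `Uᵒ` letters of R2/R3 and RU (✓13K-U) by name.

No definitions; standard axioms.  HONEST LABEL: helper-grade glue for K4′ of an UNSTAFFED stub; ⟨24004⟩ ⟨24336⟩ remain OPEN; route AllWindowsColdBox is DRAFT;
no crux, rung or summit is proved; the Yang–Mills mass gap is NOT proved by this file; no summit is proved by a line.
-/

set_option autoImplicit false

noncomputable section

open MeasureTheory Set

namespace Summit.QuantumFields.YangMills.Theorems.AllWindowsColdBoxBoxHighLine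

namespace GaussRestrict

variable {H : ℕ} {β : ℝ}

/-! ## §1 Helpers over `μ_D` -/

section Helpers

variable (hβ : 0 < β) {D : Set (LandauFree H → E3)} (hDm : MeasurableSet D) (hD : 0 < ∫ a, D.indicator (fun _ => (1 : ℝ)) a * gaussWeight β H a)

include hβ hDm hD in
/-- `E_0[F] ≥ 0` over `μ_D` when `F ≥ 0` on `D`. -/
theorem tiltExp_muSet_zero_nonneg_on (W : (LandauFree H → E3) → ℝ) {F : (LandauFree H → E3) → ℝ} (hF : ∀ a ∈ D, 0 ≤ F a) :
    0 ≤ Tilt.tiltExp ((((volume : Measure (LandauFree H → E3)).restrict D).withDensity fun a => ENNReal.ofReal (gaussWeight β H a))) W 0 F := by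
  rw [tiltExp_muSet_zero_eq hβ hDm]
  have hZ := EdgeChartGaussian.integral_gaussWeight_pos H hβ
  have hpos : 0 < gaussAvg β H (D.indicator (fun _ => (1 : ℝ))) := by unfold gaussAvg; exact div_pos hD hZ
  refine div_nonneg (EdgeChartGaussian.gaussAvg_nonneg H hβ fun a => ?_) hpos.le
  by_cases ha : a ∈ D
  · rw [Set.indicator_of_mem ha, one_mul]; exact hF a ha
  · rw [Set.indicator_of_notMem ha, zero_mul]

include hβ hDm hD in
/-- Monotonicity of `E_0` over `μ_D` for observables measurable and bounded on `D`: `F ≤ G` on `D` ⇒ `E_0 F ≤ E_0 G`. -/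
theorem tiltExp_muSet_zero_mono_on (W : (LandauFree H → E3) → ℝ) {F G : (LandauFree H → E3) → ℝ} {B : ℝ} (hB : 0 ≤ B) (mF : Measurable F)
    (mG : Measurable G) (bF : ∀ a ∈ D, |F a| ≤ B) (bG : ∀ a ∈ D, |G a| ≤ B) (hFG : ∀ a ∈ D, F a ≤ G a) :
    Tilt.tiltExp ((((volume : Measure (LandauFree H → E3)).restrict D).withDensity fun a => ENNReal.ofReal (gaussWeight β H a))) W 0 F ≤
      Tilt.tiltExp ((((volume : Measure (LandauFree H → E3)).restrict D).withDensity fun a => ENNReal.ofReal (gaussWeight β H a))) W 0 G := by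
  have h := tiltExp_muSet_zero_nonneg_on hβ hDm hD W (F := fun a => G a - F a) fun a ha => sub_nonneg.2 (hFG a ha)
  rw [tiltExp_muSet_zero_sub hβ hDm W hB mG mF bG bF] at h
  linarith

include hDm in
/-- **Cauchy–Schwarz over `μ_D`** for observables measurable and bounded on `D`: `|E_0[FG]| ≤ √E_0[F²]·√E_0[G²]`. -/
theorem abs_tiltExp_muSet_zero_pair_le (W : (LandauFree H → E3) → ℝ) {F G : (LandauFree H → E3) → ℝ} {B : ℝ} (hB : 0 ≤ B) (mF : Measurable F)
    (mG : Measurable G) (bF : ∀ a ∈ D, |F a| ≤ B) (bG : ∀ a ∈ D, |G a| ≤ B) :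
    |Tilt.tiltExp ((((volume : Measure (LandauFree H → E3)).restrict D).withDensity fun a => ENNReal.ofReal (gaussWeight β H a))) W 0 (fun a => F a * G a)| ≤
      Real.sqrt (Tilt.tiltExp ((((volume : Measure (LandauFree H → E3)).restrict D).withDensity fun a => ENNReal.ofReal (gaussWeight β H a))) W 0 (fun a => F a ^ 2)) *
        Real.sqrt (Tilt.tiltExp ((((volume : Measure (LandauFree H → E3)).restrict D).withDensity fun a => ENNReal.ofReal (gaussWeight β H a))) W 0 (fun a => G a ^ 2)) := by
  have hon : ∀ a ∈ D, D.indicator (fun _ => (1 : ℝ)) a = 1 := fun a ha => Set.indicator_of_mem ha _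
  have eFG : ∀ a ∈ D, F a * G a = (D.indicator (fun _ => (1 : ℝ)) a * F a) * (D.indicator (fun _ => (1 : ℝ)) a * G a) :=
    fun a ha => by rw [hon a ha]; ring
  have eF : ∀ a ∈ D, F a ^ 2 = (D.indicator (fun _ => (1 : ℝ)) a * F a) ^ 2 := fun a ha => by rw [hon a ha, one_mul]
  have eG : ∀ a ∈ D, G a ^ 2 = (D.indicator (fun _ => (1 : ℝ)) a * G a) ^ 2 := fun a ha => by rw [hon a ha, one_mul]
  rw [tiltExp_muSet_congr_on β hDm W 0 eFG, tiltExp_muSet_congr_on β hDm W 0 eF, tiltExp_muSet_congr_on β hDm W 0 eG]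
  have mI : Measurable (D.indicator (fun _ => (1 : ℝ))) := measurable_const.indicator hDm
  exact Tilt.abs_tiltExp_mul_le (mI.mul mF) (mI.mul mG) (abs_indicator_one_mul_le hB bF) (abs_indicator_one_mul_le hB bG) W 0

include hβ hDm hD in
/-- **Variance minimality over `μ_D`**: `E_0[(V − E_0 V)²] ≤ E_0[(V − b)²]` for any constant `b` (`V` measurable, bounded on `D`). -/
theorem tiltExp_muSet_zero_centredSq_le (W : (LandauFree H → E3) → ℝ) {V : (LandauFree H → E3) → ℝ} {B : ℝ} (hB : 0 ≤ B) (mV : Measurable V)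
    (bV : ∀ a ∈ D, |V a| ≤ B) (b : ℝ) :
    Tilt.tiltExp ((((volume : Measure (LandauFree H → E3)).restrict D).withDensity fun a => ENNReal.ofReal (gaussWeight β H a))) W 0
        (fun a => (V a - Tilt.tiltExp ((((volume : Measure (LandauFree H → E3)).restrict D).withDensity fun a => ENNReal.ofReal (gaussWeight β H a))) W 0 V) ^ 2) ≤
      Tilt.tiltExp ((((volume : Measure (LandauFree H → E3)).restrict D).withDensity fun a => ENNReal.ofReal (gaussWeight β H a))) W 0 (fun a => (V a - b) ^ 2) := by
  haveI := isFiniteMeasure_muSet hβ D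
  haveI := neZero_muSet hβ hDm hD
  set μD := (((volume : Measure (LandauFree H → E3)).restrict D).withDensity fun a => ENNReal.ofReal (gaussWeight β H a)) with hμD
  -- pass everything to the truncations `1_D·V`, `1_D·W` (globally bounded) in the letter `1_D·W`… but `W` need not be bounded: use the letter `V'`
  have mI : Measurable (D.indicator (fun _ => (1 : ℝ))) := measurable_const.indicator hDm
  set V' : (LandauFree H → E3) → ℝ := fun a => D.indicator (fun _ => (1 : ℝ)) a * V a with hV'
  have mV' : Measurable V' := mI.mul mV
  have bV' : ∀ a, |V' a| ≤ B := abs_indicator_one_mul_le hB bV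
  have aV : V =ᵐ[μD] V' := ae_muSet_eq_indicator_mul β hDm V
  -- change the tilt letter to `V'` (t = 0) and the observable to `V'`
  have h1 : Tilt.tiltExp μD W 0 V = Tilt.tiltExp μD V' 0 V' := by
    rw [tiltExp_zero_tilt_irrel μD W V' V]; exact Tilt.tiltExp_congr_ae (Filter.EventuallyEq.refl _ _) aV 0
  have h2 : Tilt.tiltExp μD W 0 (fun a => (V a - Tilt.tiltExp μD V' 0 V') ^ 2) = Tilt.tiltExp μD V' 0 (fun a => (V' a - Tilt.tiltExp μD V' 0 V') ^ 2) := by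
    rw [tiltExp_zero_tilt_irrel μD W V']
    refine Tilt.tiltExp_congr_ae (Filter.EventuallyEq.refl _ _) ?_ 0
    filter_upwards [aV] with a ha; rw [ha]
  have h3 : Tilt.tiltExp μD W 0 (fun a => (V a - b) ^ 2) = Tilt.tiltExp μD V' 0 (fun a => (V' a - b) ^ 2) := by
    rw [tiltExp_zero_tilt_irrel μD W V']
    refine Tilt.tiltExp_congr_ae (Filter.EventuallyEq.refl _ _) ?_ 0
    filter_upwards [aV] with a ha; rw [ha]
  rw [h1, h2, h3]
  exact Tilt.tiltExp_centredSq_le mV' mV' bV' bV' 0 b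

end Helpers

/-! ## §2 The parity reduction of the cross term -/

/-- ★ **Parity reduction of `CROSS(Xᵉ+Xᵒ, Yᵉ+Yᵒ; A, V)` over a symmetric `D`** (`Xᵉ, Yᵉ, V` even; `Xᵒ, Yᵒ, A` odd; all measurable and bounded by `B` on `D`; `E = E_0^{μ_D}`
in any tilt letter `W`):
`E[X̃ỸÃṼ] − E[X̃Ỹ]E[ÃṼ] − E[X̃Ã]E[ỸṼ] − E[X̃Ṽ]E[ỸÃ] = E[X̃ᵉ·Yᵒ·A·Ṽ] + E[Xᵒ·Ỹᵉ·A·Ṽ] − E[Xᵒ·A]·E[Ỹᵉ·Ṽ] − E[X̃ᵉ·Ṽ]·E[Yᵒ·A]`. -/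
theorem cross_muSet_zero_parity_reduce (hβ : 0 < β) {D : Set (LandauFree H → E3)} (hDm : MeasurableSet D) (hsym : ∀ a, -a ∈ D ↔ a ∈ D)
    (hD : 0 < ∫ a, D.indicator (fun _ => (1 : ℝ)) a * gaussWeight β H a) (W : (LandauFree H → E3) → ℝ)
    {Xe Xo Ye Yo A V : (LandauFree H → E3) → ℝ} {B : ℝ} (hB : 0 ≤ B)
    (mXe : Measurable Xe) (mXo : Measurable Xo) (mYe : Measurable Ye) (mYo : Measurable Yo) (mA : Measurable A) (mV : Measurable V)
    (bXe : ∀ a ∈ D, |Xe a| ≤ B) (bXo : ∀ a ∈ D, |Xo a| ≤ B) (bYe : ∀ a ∈ D, |Ye a| ≤ B) (bYo : ∀ a ∈ D, |Yo a| ≤ B)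
    (bA : ∀ a ∈ D, |A a| ≤ B) (bV : ∀ a ∈ D, |V a| ≤ B)
    (pXe : ∀ a, Xe (-a) = Xe a) (pXo : ∀ a, Xo (-a) = -Xo a) (pYe : ∀ a, Ye (-a) = Ye a) (pYo : ∀ a, Yo (-a) = -Yo a)
    (pA : ∀ a, A (-a) = -A a) (pV : ∀ a, V (-a) = V a) :
    let μD : Measure (LandauFree H → E3) := (((volume : Measure (LandauFree H → E3)).restrict D).withDensity fun a => ENNReal.ofReal (gaussWeight β H a))
    let E : ((LandauFree H → E3) → ℝ) → ℝ := fun G => Tilt.tiltExp μD W 0 G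
    E (fun a => (Xe a + Xo a - E (fun a => Xe a + Xo a)) * (Ye a + Yo a - E (fun a => Ye a + Yo a)) * (A a - E A) * (V a - E V)) -
        E (fun a => (Xe a + Xo a - E (fun a => Xe a + Xo a)) * (Ye a + Yo a - E (fun a => Ye a + Yo a))) * E (fun a => (A a - E A) * (V a - E V)) -
        E (fun a => (Xe a + Xo a - E (fun a => Xe a + Xo a)) * (A a - E A)) * E (fun a => (Ye a + Yo a - E (fun a => Ye a + Yo a)) * (V a - E V)) -
        E (fun a => (Xe a + Xo a - E (fun a => Xe a + Xo a)) * (V a - E V)) * E (fun a => (Ye a + Yo a - E (fun a => Ye a + Yo a)) * (A a - E A)) =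
      E (fun a => (Xe a - E Xe) * Yo a * A a * (V a - E V)) + E (fun a => Xo a * (Ye a - E Ye) * A a * (V a - E V)) -
        E (fun a => Xo a * A a) * E (fun a => (Ye a - E Ye) * (V a - E V)) -
        E (fun a => (Xe a - E Xe) * (V a - E V)) * E (fun a => Yo a * A a) := by
  intro μD E
  -- means of the odd parts vanish
  have hXo : E Xo = 0 := tiltExp_muSet_zero_eq_zero_of_odd hβ hDm hsym W pXo
  have hYo : E Yo = 0 := tiltExp_muSet_zero_eq_zero_of_odd hβ hDm hsym W pYo
  have hA : E A = 0 := tiltExp_muSet_zero_eq_zero_of_odd hβ hDm hsym W pA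
  have hEX : E (fun a => Xe a + Xo a) = E Xe := by
    show Tilt.tiltExp μD W 0 (fun a => Xe a + Xo a) = Tilt.tiltExp μD W 0 Xe
    rw [tiltExp_muSet_zero_add hβ hDm W hB mXe mXo bXe bXo]
    show E Xe + E Xo = E Xe
    rw [hXo, add_zero]
  have hEY : E (fun a => Ye a + Yo a) = E Ye := by
    show Tilt.tiltExp μD W 0 (fun a => Ye a + Yo a) = Tilt.tiltExp μD W 0 Ye
    rw [tiltExp_muSet_zero_add hβ hDm W hB mYe mYo bYe bYo]
    show E Ye + E Yo = E Ye
    rw [hYo, add_zero]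
  rw [hEX, hEY, hA]
  simp only [sub_zero]
  set cx := E Xe with hcx
  set cy := E Ye with hcy
  set cv := E V with hcv
  -- bounds of the means and of the centred even parts
  have bcx : |cx| ≤ B := abs_tiltExp_muSet_zero_le hβ hDm hD W hB bXe
  have bcy : |cy| ≤ B := abs_tiltExp_muSet_zero_le hβ hDm hD W hB bYe
  have bcv : |cv| ≤ B := abs_tiltExp_muSet_zero_le hβ hDm hD W hB bV
  have h2B : 0 ≤ 2 * B := by linarith
  have cen : ∀ {Z : (LandauFree H → E3) → ℝ} {m : ℝ}, (∀ a ∈ D, |Z a| ≤ B) → |m| ≤ B → ∀ a ∈ D, |Z a - m| ≤ 2 * B :=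
    fun hZ hm a ha => (abs_sub _ _).trans (by linarith [hZ a ha])
  have b2 : ∀ {Z : (LandauFree H → E3) → ℝ}, (∀ a ∈ D, |Z a| ≤ B) → ∀ a ∈ D, |Z a| ≤ 2 * B := fun hZ a ha => (hZ a ha).trans (by linarith)
  have cX := cen bXe bcx
  have cY := cen bYe bcy
  have cV := cen bV bcv
  have dXo := b2 bXo
  have dYo := b2 bYo
  have dA := b2 bA
  have mcX : Measurable fun a => Xe a - cx := mXe.sub measurable_const
  have mcY : Measurable fun a => Ye a - cy := mYe.sub measurable_const
  have mcV : Measurable fun a => V a - cv := mV.sub measurable_const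
  have pcX : ∀ a, Xe (-a) - cx = Xe a - cx := fun a => by rw [pXe]
  have pcY : ∀ a, Ye (-a) - cy = Ye a - cy := fun a => by rw [pYe]
  have pcV : ∀ a, V (-a) - cv = V a - cv := fun a => by rw [pV]
  -- bounded products on D
  have bm2 : ∀ {P Q : (LandauFree H → E3) → ℝ}, (∀ a ∈ D, |P a| ≤ 2 * B) → (∀ a ∈ D, |Q a| ≤ 2 * B) → ∀ a ∈ D, |P a * Q a| ≤ (2 * B) ^ 2 :=
    fun hP hQ a ha => by rw [abs_mul, sq]; exact mul_le_mul (hP a ha) (hQ a ha) (abs_nonneg _) h2B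
  have bm4 : ∀ {P Q R S : (LandauFree H → E3) → ℝ}, (∀ a ∈ D, |P a| ≤ 2 * B) → (∀ a ∈ D, |Q a| ≤ 2 * B) → (∀ a ∈ D, |R a| ≤ 2 * B) →
      (∀ a ∈ D, |S a| ≤ 2 * B) → ∀ a ∈ D, |P a * Q a * R a * S a| ≤ (2 * B) ^ 4 := by
    intro P Q R S hP hQ hR hS a ha
    rw [abs_mul, abs_mul, show (2 * B) ^ 4 = (2 * B) ^ 2 * (2 * B) * (2 * B) by ring]
    exact mul_le_mul (mul_le_mul (bm2 hP hQ a ha) (hR a ha) (abs_nonneg _) (sq_nonneg _)) (hS a ha) (abs_nonneg _)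
      (mul_nonneg (sq_nonneg _) h2B)
  -- ### term 1: the four-product splits into four parity classes, two of which vanish
  have e1 : (fun a => (Xe a + Xo a - cx) * (Ye a + Yo a - cy) * A a * (V a - cv)) = fun a =>
      ((Xe a - cx) * Yo a * A a * (V a - cv) + Xo a * (Ye a - cy) * A a * (V a - cv)) +
        ((Xe a - cx) * (Ye a - cy) * A a * (V a - cv) + Xo a * Yo a * A a * (V a - cv)) := by funext a; ring
  have n1 : Measurable fun a => (Xe a - cx) * Yo a * A a * (V a - cv) := ((mcX.mul mYo).mul mA).mul mcV
  have n2 : Measurable fun a => Xo a * (Ye a - cy) * A a * (V a - cv) := ((mXo.mul mcY).mul mA).mul mcV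
  have n3 : Measurable fun a => (Xe a - cx) * (Ye a - cy) * A a * (V a - cv) := ((mcX.mul mcY).mul mA).mul mcV
  have n4 : Measurable fun a => Xo a * Yo a * A a * (V a - cv) := ((mXo.mul mYo).mul mA).mul mcV
  have q1 := bm4 cX dYo dA cV
  have q2 := bm4 dXo cY dA cV
  have q3 := bm4 cX cY dA cV
  have q4 := bm4 dXo dYo dA cV
  have hq4 : 0 ≤ (2 * B) ^ 4 := by positivity
  have add2 : ∀ {F G : (LandauFree H → E3) → ℝ} {C : ℝ}, (∀ a ∈ D, |F a| ≤ C) → (∀ a ∈ D, |G a| ≤ C) →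
      ∀ a ∈ D, |F a + G a| ≤ 2 * C := fun hF hG a ha => (abs_add_le _ _).trans (by linarith [hF a ha, hG a ha])
  have n12 : Measurable fun a => (Xe a - cx) * Yo a * A a * (V a - cv) + Xo a * (Ye a - cy) * A a * (V a - cv) := n1.add n2
  have n34 : Measurable fun a => (Xe a - cx) * (Ye a - cy) * A a * (V a - cv) + Xo a * Yo a * A a * (V a - cv) := n3.add n4
  have z3 : Tilt.tiltExp μD W 0 (fun a => (Xe a - cx) * (Ye a - cy) * A a * (V a - cv)) = 0 :=
    tiltExp_muSet_zero_eq_zero_of_odd hβ hDm hsym W fun a => by rw [pcX, pcY, pA, pcV]; ring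
  have z4 : Tilt.tiltExp μD W 0 (fun a => Xo a * Yo a * A a * (V a - cv)) = 0 :=
    tiltExp_muSet_zero_eq_zero_of_odd hβ hDm hsym W fun a => by rw [pXo, pYo, pA, pcV]; ring
  have T1 : E (fun a => (Xe a + Xo a - cx) * (Ye a + Yo a - cy) * A a * (V a - cv)) =
      E (fun a => (Xe a - cx) * Yo a * A a * (V a - cv)) + E (fun a => Xo a * (Ye a - cy) * A a * (V a - cv)) := by
    show Tilt.tiltExp μD W 0 _ = Tilt.tiltExp μD W 0 _ + Tilt.tiltExp μD W 0 _
    rw [e1, tiltExp_muSet_zero_add hβ hDm W (by positivity : (0 : ℝ) ≤ 2 * (2 * B) ^ 4) n12 n34 (add2 q1 q2) (add2 q3 q4),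
      tiltExp_muSet_zero_add hβ hDm W hq4 n1 n2 q1 q2, tiltExp_muSet_zero_add hβ hDm W hq4 n3 n4 q3 q4, z3, z4]
    ring
  -- ### term 2: `E[A·Ṽ] = 0`
  have T2 : E (fun a => A a * (V a - cv)) = 0 := tiltExp_muSet_zero_mul_eq_zero_of_odd_even hβ hDm hsym W pA pcV
  -- ### term 3: `E[(X̃ᵉ+Xo)·A] = E[Xo·A]`, `E[(Ỹᵉ+Yo)·Ṽ] = E[Ỹᵉ·Ṽ]`
  have hq2 : 0 ≤ (2 * B) ^ 2 := sq_nonneg _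
  have T3a : E (fun a => (Xe a + Xo a - cx) * A a) = E (fun a => Xo a * A a) := by
    show Tilt.tiltExp μD W 0 _ = Tilt.tiltExp μD W 0 _
    have e : (fun a => (Xe a + Xo a - cx) * A a) = fun a => (Xe a - cx) * A a + Xo a * A a := by funext a; ring
    have m1 : Measurable fun a => (Xe a - cx) * A a := mcX.mul mA
    have m2 : Measurable fun a => Xo a * A a := mXo.mul mA
    rw [e, tiltExp_muSet_zero_add hβ hDm W hq2 m1 m2 (bm2 cX dA) (bm2 dXo dA),
      tiltExp_muSet_zero_mul_eq_zero_of_even_odd hβ hDm hsym W pcX pA, zero_add]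
  have T3b : E (fun a => (Ye a + Yo a - cy) * (V a - cv)) = E (fun a => (Ye a - cy) * (V a - cv)) := by
    show Tilt.tiltExp μD W 0 _ = Tilt.tiltExp μD W 0 _
    have e : (fun a => (Ye a + Yo a - cy) * (V a - cv)) = fun a => (Ye a - cy) * (V a - cv) + Yo a * (V a - cv) := by funext a; ring
    have m1 : Measurable fun a => (Ye a - cy) * (V a - cv) := mcY.mul mcV
    have m2 : Measurable fun a => Yo a * (V a - cv) := mYo.mul mcV
    rw [e, tiltExp_muSet_zero_add hβ hDm W hq2 m1 m2 (bm2 cY cV) (bm2 dYo cV),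
      tiltExp_muSet_zero_mul_eq_zero_of_odd_even hβ hDm hsym W pYo pcV, add_zero]
  -- ### term 4: `E[(X̃ᵉ+Xo)·Ṽ] = E[X̃ᵉ·Ṽ]`, `E[(Ỹᵉ+Yo)·A] = E[Yo·A]`
  have T4a : E (fun a => (Xe a + Xo a - cx) * (V a - cv)) = E (fun a => (Xe a - cx) * (V a - cv)) := by
    show Tilt.tiltExp μD W 0 _ = Tilt.tiltExp μD W 0 _
    have e : (fun a => (Xe a + Xo a - cx) * (V a - cv)) = fun a => (Xe a - cx) * (V a - cv) + Xo a * (V a - cv) := by funext a; ring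
    have m1 : Measurable fun a => (Xe a - cx) * (V a - cv) := mcX.mul mcV
    have m2 : Measurable fun a => Xo a * (V a - cv) := mXo.mul mcV
    rw [e, tiltExp_muSet_zero_add hβ hDm W hq2 m1 m2 (bm2 cX cV) (bm2 dXo cV),
      tiltExp_muSet_zero_mul_eq_zero_of_odd_even hβ hDm hsym W pXo pcV, add_zero]
  have T4b : E (fun a => (Ye a + Yo a - cy) * A a) = E (fun a => Yo a * A a) := by
    show Tilt.tiltExp μD W 0 _ = Tilt.tiltExp μD W 0 _
    have e : (fun a => (Ye a + Yo a - cy) * A a) = fun a => (Ye a - cy) * A a + Yo a * A a := by funext a; ring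
    have m1 : Measurable fun a => (Ye a - cy) * A a := mcY.mul mA
    have m2 : Measurable fun a => Yo a * A a := mYo.mul mA
    rw [e, tiltExp_muSet_zero_add hβ hDm W hq2 m1 m2 (bm2 cY dA) (bm2 dYo dA),
      tiltExp_muSet_zero_mul_eq_zero_of_even_odd hβ hDm hsym W pcY pA, zero_add]
  rw [T1, T2, T3a, T3b, T4a, T4b]
  ring

end GaussRestrict

end Summit.QuantumFields.YangMills.Theorems.AllWindowsColdBoxBoxHighLine

end
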